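import Summits.QuantumFields.BalabanUV.Beta.EriceFlowEnclosureUnitStepTailLaw

/-!
# Beta / EriceFlowEnclosureUnitStepTailLawEnd — THE TAIL OF A SLOWLY OSCILLATING C² FUNCTION ALONG AN ALMOST-UNIT-STEP SEQUENCE, TO SECOND ORDER
# (P2 #56d-B, part 2 of 2; abstract service for the bare-side sharpness witness): for `u_j` with steps `s_j = u_{j+1} − u_j ∈ [1∕2, 2]`,
# `|s_j − 1| ≤ σ∕u_{j+1}²`, `u_0 ≥ 1`, and g ∈ C² on [1, ∞) with `|g| ≤ C_g∕x²`, `|g″| ≤ C₂∕x³`, `F′ = −g`, `|F| ≤ C_F∕x`: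
#     **`|Σ_{j>K} g(u_j) − F(u_K)| ≤ A∕u_K²`,  A = C_g∕2 + 9(4C₂ + σC_g)`**
# — the trajectory remainder sum IS the tail integral `∫_{u_K}^∞ g = F(u_K)` up to `O(u_K⁻²)`, although the first-order Riemann error
# `Σ_{j≥K} sup|g′|` is only `O(u_K^{−3∕2})` for the witness (g′ ≍ x^{−5∕2}): the trapezoid rule (part 1) pays `s³ sup|g″|∕2 = O(u⁻³)` per cell,
# the half-differences `(g(u_j) − g(u_{j+1}))∕2` TELESCOPE to `g(u_K)∕2 = O(u_K⁻²)`, and the step defects cost `σC_g∕u⁴`.  Plus the first-order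
# law for a bounded C¹ function G with `|G′| ≤ C₁∕x` and primitive S:
#     **`|Σ_{K<N} G(u_K) − (S(u_N) − S(u_0))| ≤ 8C₁·H_N + 6σ·C_G`**  (H_N the harmonic mass).
# P2 #56d-C reads both on β_W's trajectories (`u_j = 1∕h_j`, g = the (3.73)-remainder in the inverse coupling, F(u_K) = h_K·V(h_K),
# G = cos√x∕√x, S = 2 sin√x).  Pure [folklore] (Euler–Maclaurin to second order on an irregular grid); no Erice sentence occurs.
#   §4 HEADLINE **`tail_finite_le`** (K ≤ J, exact boundary terms `F(u_J)`, `g(u_J)∕2`) and END **`tail_law`** (`|Σ'_{i} g(u_{K+1+i}) − F(u_K)| ≤ A∕u_K²`);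
#   §5 **`firstOrder_sum_le`**.
# (β-flow team, prover 2 = lower ∕ positivity side, unit `b2b-balaban-beta-bflow-p2`, gen 39; module P2 #56d-B2)

HONEST FRAMING (page 1 of everything the β sub-cell writes): discharging `BetaPertH` makes Bałaban's UV stability UNCONDITIONAL — a
real constructive-QFT result; it is NOT the continuum limit and NOT the Clay problem.  HONEST DEPENDENCY (cell reorg 2026-08-19,
verbatim): «continuum YM on T⁴ ⇐ BetaPertH ∧ nine spine estimates (0/9 proved); BetaPertH ⇐ (D1) ∧ (D4) ∧ CAP+tail; G-an2-4 gates
asym, D1 and NE2/3/4.»  THIS MODULE DISCHARGES NOTHING and quotes nothing: [folklore] real analysis on abstract data (g, F, G, S, u).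

WHAT THIS FILE PROVES (0 sorry, 0 def): §4 HEADLINE **`tail_finite_le`**, END **`tail_law`**; §5 **`firstOrder_sum_le`**.
NOT CLAIMED: anything on (3.62) ∕ β (P2 #56d-C); `BetaPertH`; continuum; Clay.
-/

namespace Summit.QuantumFields.BalabanUV.Beta.EriceFlowEnclosureUnitStepTailLawEnd

open Set Filter Topology MeasureTheory intervalIntegral Finset
open Summit.QuantumFields.BalabanUV.Beta.EriceFlowEnclosureUnitStepTailLaw

noncomputable section

variable {g g₁ g₂ F G G₁ S : ℝ → ℝ} {u : ℕ → ℝ} {Cg C₂ CF CG C₁ σ : ℝ}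

/-! ## §4 The tail law -/

/-- **HEADLINE — THE FINITE TAIL LAW.**  u with `u_0 ≥ 1`, steps in [1∕2, 2] and `|s_j − 1| ≤ σ∕u_{j+1}²` (σ ≥ 0); g with `g′ = g₁`, `g₁′ = g₂`
on [1, ∞), g₂ continuous there, `|g x| ≤ C_g∕x²`, `|g₂ x| ≤ C₂∕x³`; F with `F′ = −g` on [1, ∞).  Then for `K ≤ J`:
**`|Σ_{K ≤ j < J} g(u_{j+1}) − (F(u_K) − F(u_J)) + (g(u_K) − g(u_J))∕2| ≤ 9(4C₂ + σC_g)∕u_K²`**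
(per cell: `g(u_{j+1}) = ∫_{cell} g − (g_j − g_{j+1})∕2 + [trapezoid error] − (s_j − 1)(g_j + g_{j+1})∕2`, §1 + §3). [folklore] -/
theorem tail_finite_le (hu0 : 1 ≤ u 0) (hstep : ∀ j, 1 / 2 ≤ u (j + 1) - u j ∧ u (j + 1) - u j ≤ 2)
    (hσ0 : 0 ≤ σ) (hσ : ∀ j, |u (j + 1) - u j - 1| ≤ σ / u (j + 1) ^ 2)
    (hg : ∀ x : ℝ, 1 ≤ x → HasDerivAt g (g₁ x) x) (hg₁ : ∀ x : ℝ, 1 ≤ x → HasDerivAt g₁ (g₂ x) x)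
    (hg₂c : ContinuousOn g₂ (Ici 1)) (hCg : 0 ≤ Cg) (hgb : ∀ x : ℝ, 1 ≤ x → |g x| ≤ Cg / x ^ 2)
    (hg₂b : ∀ x : ℝ, 1 ≤ x → |g₂ x| ≤ C₂ / x ^ 3)
    (hF : ∀ x : ℝ, 1 ≤ x → HasDerivAt F (-g x) x) {K J : ℕ} (hKJ : K ≤ J) :
    |∑ j ∈ Ico K J, g (u (j + 1)) - (F (u K) - F (u J)) + (g (u K) - g (u J)) / 2| ≤ 9 * (4 * C₂ + σ * Cg) / u K ^ 2 := by
  have hpos := u_pos hu0 hstep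
  have hone := u_one_le hu0 hstep
  have hC₂ : 0 ≤ C₂ := by
    have h := (abs_nonneg _).trans (hg₂b 1 le_rfl)
    simpa using h
  -- the cell data
  have hcell : ∀ j, u j ≤ u (j + 1) := fun j => by have := (hstep j).1; linarith
  have hgI : ∀ j, ∀ x ∈ Icc (u j) (u (j + 1)), HasDerivAt g (g₁ x) x := fun j x hx => hg x ((hone j).trans hx.1)
  have hg₁I : ∀ j, ∀ x ∈ Icc (u j) (u (j + 1)), HasDerivAt g₁ (g₂ x) x := fun j x hx => hg₁ x ((hone j).trans hx.1)
  have hg₂I : ∀ j, ContinuousOn g₂ (Icc (u j) (u (j + 1))) := fun j => hg₂c.mono fun x hx => (hone j).trans hx.1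
  -- per-cell trapezoid error ≤ s³/2 · C₂/u_j³ ≤ 4C₂/u_j³
  have htrap : ∀ j, |(u (j + 1) - u j) * (g (u j) + g (u (j + 1))) / 2 - ∫ x in (u j)..(u (j + 1)), g x|
      ≤ 4 * C₂ / u j ^ 3 := by
    intro j
    have hb : ∀ x ∈ Icc (u j) (u (j + 1)), |g₂ x| ≤ C₂ / u j ^ 3 := by
      intro x hx
      refine (hg₂b x ((hone j).trans hx.1)).trans ?_
      exact div_le_div_of_nonneg_left hC₂ (pow_pos (hpos j) 3) (pow_le_pow_left₀ (hpos j).le hx.1 3)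
    refine (trapezoid_error_le (hcell j) (hgI j) (hg₁I j) (hg₂I j) hb).trans ?_
    have hs2 := (hstep j).2
    have hs0 : 0 ≤ u (j + 1) - u j := sub_nonneg.mpr (hcell j)
    have hs3 : (u (j + 1) - u j) ^ 3 ≤ 8 := by nlinarith [pow_le_pow_left₀ hs0 hs2 3]
    have hujpos := hpos j
    have : 0 ≤ C₂ / u j ^ 3 := by positivity
    calc (u (j + 1) - u j) ^ 3 * (C₂ / u j ^ 3) / 2 ≤ 8 * (C₂ / u j ^ 3) / 2 :=
          div_le_div_of_nonneg_right (mul_le_mul_of_nonneg_right hs3 this) (by norm_num)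
      _ = 4 * C₂ / u j ^ 3 := by ring
  -- per-cell step defect ≤ σ Cg/u_j³
  have hdef : ∀ j, |(u (j + 1) - u j - 1) * (g (u j) + g (u (j + 1))) / 2| ≤ σ * Cg / u j ^ 3 := by
    intro j
    have h1 := hσ j
    have hgj := hgb (u j) (hone j)
    have hgj1 := hgb (u (j + 1)) (hone (j + 1))
    have hujj : u j ≤ u (j + 1) := hcell j
    have hinv1 : 1 / u (j + 1) ^ 2 ≤ 1 / u j ^ 2 :=
      one_div_le_one_div_of_le (pow_pos (hpos j) 2) (pow_le_pow_left₀ (hpos j).le hujj 2)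
    have hsum : |g (u j) + g (u (j + 1))| ≤ 2 * Cg / u j ^ 2 := by
      calc |g (u j) + g (u (j + 1))| ≤ Cg / u j ^ 2 + Cg / u (j + 1) ^ 2 := (abs_add_le _ _).trans (add_le_add hgj hgj1)
        _ ≤ Cg / u j ^ 2 + Cg / u j ^ 2 := by
            have : Cg / u (j + 1) ^ 2 ≤ Cg / u j ^ 2 := by
              rw [div_eq_mul_one_div, div_eq_mul_one_div Cg]; exact mul_le_mul_of_nonneg_left hinv1 hCg
            linarith
        _ = 2 * Cg / u j ^ 2 := by ring
    rw [abs_div, abs_mul, abs_of_pos (by norm_num : (0:ℝ) < 2)]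
    have hσb : |u (j + 1) - u j - 1| ≤ σ / u j ^ 2 := h1.trans (by
      rw [div_eq_mul_one_div, div_eq_mul_one_div σ]; exact mul_le_mul_of_nonneg_left hinv1 hσ0)
    have huj1 : 1 ≤ u j ^ 2 := one_le_pow₀ (hone j)
    have hujpos := hpos j
    have hprod : |u (j + 1) - u j - 1| * |g (u j) + g (u (j + 1))| ≤ (σ / u j ^ 2) * (2 * Cg / u j ^ 2) :=
      mul_le_mul hσb hsum (abs_nonneg _) (by positivity)
    have hu34 : u j ^ 3 ≤ u j ^ 2 * u j ^ 2 := by nlinarith [pow_pos hujpos 3, hone j]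
    calc |u (j + 1) - u j - 1| * |g (u j) + g (u (j + 1))| / 2 ≤ (σ / u j ^ 2) * (2 * Cg / u j ^ 2) / 2 :=
          div_le_div_of_nonneg_right hprod (by norm_num)
      _ = σ * Cg / (u j ^ 2 * u j ^ 2) := by field_simp
      _ ≤ σ * Cg / u j ^ 3 := div_le_div_of_nonneg_left (by positivity) (pow_pos hujpos 3) hu34
  -- the cell identity (pure algebra) and the sum
  have hcellid : ∀ j, g (u (j + 1)) = (∫ x in (u j)..(u (j + 1)), g x) - (g (u j) - g (u (j + 1))) / 2
      + (((u (j + 1) - u j) * (g (u j) + g (u (j + 1))) / 2 - ∫ x in (u j)..(u (j + 1)), g x)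
        - (u (j + 1) - u j - 1) * (g (u j) + g (u (j + 1))) / 2) := fun j => by ring
  have htel : ∀ (f : ℕ → ℝ) (J : ℕ), K ≤ J → ∑ j ∈ Ico K J, (f j - f (j + 1)) = f K - f J := by
    intro f J hJ
    induction J, hJ using Nat.le_induction with
    | base => simp
    | succ J hJ ih => rw [Finset.sum_Ico_succ_top hJ, ih]; ring
  have hInt : ∑ j ∈ Ico K J, ∫ x in (u j)..(u (j + 1)), g x = F (u K) - F (u J) := by
    have hgc : ∀ j, IntervalIntegrable g volume (u j) (u (j + 1)) := fun j =>
      (ContinuousOn.intervalIntegrable_of_Icc (hcell j) fun x hx => (hgI j x hx).continuousAt.continuousWithinAt)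
    have hcellF : ∀ j, ∫ x in (u j)..(u (j + 1)), g x = F (u j) - F (u (j + 1)) := by
      intro j
      have hderiv : ∀ x ∈ uIcc (u j) (u (j + 1)), HasDerivAt F (-g x) x := by
        intro x hx; rw [uIcc_of_le (hcell j)] at hx; exact hF x ((hone j).trans hx.1)
      have h := intervalIntegral.integral_eq_sub_of_hasDerivAt hderiv (hgc j).neg
      rw [intervalIntegral.integral_neg] at h
      linarith
    rw [Finset.sum_congr rfl fun j _ => hcellF j]
    exact htel (fun j => F (u j)) J hKJ
  have hTel : ∑ j ∈ Ico K J, (g (u j) - g (u (j + 1))) / 2 = (g (u K) - g (u J)) / 2 := by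
    have e : ∀ j : ℕ, (g (u j) - g (u (j + 1))) / 2 = g (u j) / 2 - g (u (j + 1)) / 2 := fun j => by ring
    rw [Finset.sum_congr rfl fun j _ => e j, htel (fun j => g (u j) / 2) J hKJ]
    ring
  have hsplit : ∑ j ∈ Ico K J, g (u (j + 1)) = (F (u K) - F (u J)) - (g (u K) - g (u J)) / 2
      + ∑ j ∈ Ico K J, (((u (j + 1) - u j) * (g (u j) + g (u (j + 1))) / 2 - ∫ x in (u j)..(u (j + 1)), g x)
        - (u (j + 1) - u j - 1) * (g (u j) + g (u (j + 1))) / 2) := by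
    rw [Finset.sum_congr rfl fun j _ => hcellid j, Finset.sum_add_distrib, Finset.sum_sub_distrib, hInt, hTel]
  have hkey : ∑ j ∈ Ico K J, g (u (j + 1)) - (F (u K) - F (u J)) + (g (u K) - g (u J)) / 2
      = ∑ j ∈ Ico K J, (((u (j + 1) - u j) * (g (u j) + g (u (j + 1))) / 2 - ∫ x in (u j)..(u (j + 1)), g x)
        - (u (j + 1) - u j - 1) * (g (u j) + g (u (j + 1))) / 2) := by rw [hsplit]; ring
  rw [hkey]
  calc |∑ j ∈ Ico K J, (((u (j + 1) - u j) * (g (u j) + g (u (j + 1))) / 2 - ∫ x in (u j)..(u (j + 1)), g x)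
        - (u (j + 1) - u j - 1) * (g (u j) + g (u (j + 1))) / 2)|
      ≤ ∑ j ∈ Ico K J, |((u (j + 1) - u j) * (g (u j) + g (u (j + 1))) / 2 - ∫ x in (u j)..(u (j + 1)), g x)
        - (u (j + 1) - u j - 1) * (g (u j) + g (u (j + 1))) / 2| := Finset.abs_sum_le_sum_abs _ _
    _ ≤ ∑ j ∈ Ico K J, (4 * C₂ + σ * Cg) * (1 / u j ^ 3) := by
        refine Finset.sum_le_sum fun j _ => (abs_sub _ _).trans ?_
        have e : (4 * C₂ + σ * Cg) * (1 / u j ^ 3) = 4 * C₂ / u j ^ 3 + σ * Cg / u j ^ 3 := by ring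
        rw [e]; exact add_le_add (htrap j) (hdef j)
    _ = (4 * C₂ + σ * Cg) * ∑ j ∈ Ico K J, 1 / u j ^ 3 := by rw [Finset.mul_sum]
    _ ≤ (4 * C₂ + σ * Cg) * (9 / u K ^ 2) := mul_le_mul_of_nonneg_left (sum_inv_cube_le hu0 hstep hKJ) (by positivity)
    _ = 9 * (4 * C₂ + σ * Cg) / u K ^ 2 := by ring

/-- **END — THE TAIL LAW.**  Same data, plus `|F x| ≤ C_F∕x` on [1, ∞).  Then the remainder series converges and for every K:
**`|Σ'_{i ≥ 0} g(u_{K+1+i}) − F(u_K)| ≤ (C_g∕2 + 9(4C₂ + σC_g))∕u_K²`** (§4's finite law as J → ∞: `F(u_J), g(u_J) → 0` since `u_J → ∞`).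
[folklore] -/
theorem tail_law (hu0 : 1 ≤ u 0) (hstep : ∀ j, 1 / 2 ≤ u (j + 1) - u j ∧ u (j + 1) - u j ≤ 2)
    (hσ0 : 0 ≤ σ) (hσ : ∀ j, |u (j + 1) - u j - 1| ≤ σ / u (j + 1) ^ 2)
    (hg : ∀ x : ℝ, 1 ≤ x → HasDerivAt g (g₁ x) x) (hg₁ : ∀ x : ℝ, 1 ≤ x → HasDerivAt g₁ (g₂ x) x)
    (hg₂c : ContinuousOn g₂ (Ici 1)) (hCg : 0 ≤ Cg) (hgb : ∀ x : ℝ, 1 ≤ x → |g x| ≤ Cg / x ^ 2)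
    (hg₂b : ∀ x : ℝ, 1 ≤ x → |g₂ x| ≤ C₂ / x ^ 3)
    (hF : ∀ x : ℝ, 1 ≤ x → HasDerivAt F (-g x) x) (hFb : ∀ x : ℝ, 1 ≤ x → |F x| ≤ CF / x) (K : ℕ) :
    Summable (fun i : ℕ => g (u (K + 1 + i))) ∧
      |∑' i : ℕ, g (u (K + 1 + i)) - F (u K)| ≤ (Cg / 2 + 9 * (4 * C₂ + σ * Cg)) / u K ^ 2 := by
  have hpos := u_pos hu0 hstep
  have hone := u_one_le hu0 hstep
  have hlow := step_lower hu0 hstep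
  -- summability: |g(u_j)| ≤ Cg/u_j² ≤ 4Cg/(j+2)²
  have hsum : Summable (fun i : ℕ => g (u (K + 1 + i))) := by
    have h2 : Summable (fun i : ℕ => 4 * Cg * (1 / ((i : ℝ) + 2) ^ 2)) := by
      have h := (summable_nat_add_iff 2).mpr (Real.summable_one_div_nat_pow.mpr one_lt_two)
      refine (h.congr fun i => ?_).mul_left (4 * Cg)
      push_cast; ring
    refine Summable.of_norm_bounded_eventually_nat h2 ?_
    filter_upwards with i
    rw [Real.norm_eq_abs]
    refine (hgb _ (hone _)).trans ?_
    have hl := hlow (K + 1 + i)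
    have hK0 : (0:ℝ) ≤ K := Nat.cast_nonneg K
    have hi2 : ((i : ℝ) + 2) / 2 ≤ u (K + 1 + i) := by push_cast at hl ⊢; linarith
    have hi0 : (0:ℝ) < ((i : ℝ) + 2) / 2 := by positivity
    calc Cg / u (K + 1 + i) ^ 2 ≤ Cg / (((i : ℝ) + 2) / 2) ^ 2 :=
          div_le_div_of_nonneg_left hCg (pow_pos hi0 2) (pow_le_pow_left₀ hi0.le hi2 2)
      _ = 4 * Cg * (1 / ((i : ℝ) + 2) ^ 2) := by field_simp; ring
  refine ⟨hsum, ?_⟩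
  -- partial sums: Σ_{i<n} g(u(K+1+i)) = Σ_{j ∈ Ico K (K+n)} g(u(j+1))
  have hpartial : ∀ n : ℕ, ∑ i ∈ range n, g (u (K + 1 + i)) = ∑ j ∈ Ico K (K + n), g (u (j + 1)) := by
    intro n
    induction n with
    | zero => simp
    | succ n ih =>
      rw [Finset.sum_range_succ, ih, show K + (n + 1) = (K + n) + 1 by ring,
        Finset.sum_Ico_succ_top (Nat.le_add_right K n), show K + 1 + n = K + n + 1 by ring]
  -- the finite law along J = K + n, and the vanishing boundary terms
  have hfin : ∀ n : ℕ, |∑ i ∈ range n, g (u (K + 1 + i)) - (F (u K) - F (u (K + n))) + (g (u K) - g (u (K + n))) / 2|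
      ≤ 9 * (4 * C₂ + σ * Cg) / u K ^ 2 := by
    intro n
    rw [hpartial n]
    exact tail_finite_le hu0 hstep hσ0 hσ hg hg₁ hg₂c hCg hgb hg₂b hF (Nat.le_add_right K n)
  have huK : Tendsto (fun n : ℕ => u (K + n)) atTop atTop :=
    (u_tendsto_atTop hu0 hstep).comp (tendsto_atTop_atTop.mpr fun b => ⟨b, fun n hn => le_add_left hn⟩)
  have hFlim : Tendsto (fun n : ℕ => F (u (K + n))) atTop (𝓝 0) := by
    have hCF : 0 ≤ CF := by have := (abs_nonneg _).trans (hFb 1 le_rfl); simpa using this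
    have h1 : Tendsto (fun n : ℕ => CF / u (K + n)) atTop (𝓝 0) := tendsto_const_nhds.div_atTop huK
    refine squeeze_zero_norm (fun n => ?_) h1
    rw [Real.norm_eq_abs]; exact hFb _ (hone _)
  have hglim : Tendsto (fun n : ℕ => g (u (K + n))) atTop (𝓝 0) := by
    have h1 : Tendsto (fun n : ℕ => Cg / u (K + n) ^ 2) atTop (𝓝 0) :=
      tendsto_const_nhds.div_atTop (tendsto_pow_atTop two_ne_zero |>.comp huK)
    refine squeeze_zero_norm (fun n => ?_) h1
    rw [Real.norm_eq_abs]; exact hgb _ (hone _)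
  have hS := hsum.hasSum.tendsto_sum_nat
  have hexpr : Tendsto (fun n : ℕ => ∑ i ∈ range n, g (u (K + 1 + i)) - (F (u K) - F (u (K + n)))
      + (g (u K) - g (u (K + n))) / 2) atTop (𝓝 ((∑' i, g (u (K + 1 + i))) - (F (u K) - 0) + (g (u K) - 0) / 2)) :=
    (hS.sub (tendsto_const_nhds.sub hFlim)).add ((tendsto_const_nhds.sub hglim).div_const 2)
  have hlim := le_of_tendsto ((continuous_abs.tendsto _).comp hexpr) (Eventually.of_forall hfin)
  simp only [sub_zero] at hlim
  -- remove g(u_K)/2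
  have hgK : |g (u K)| / 2 ≤ Cg / 2 / u K ^ 2 := by
    have := hgb _ (hone K)
    calc |g (u K)| / 2 ≤ Cg / u K ^ 2 / 2 := by linarith
      _ = Cg / 2 / u K ^ 2 := by ring
  have htri : |∑' i, g (u (K + 1 + i)) - F (u K)| ≤ |∑' i, g (u (K + 1 + i)) - F (u K) + g (u K) / 2| + |g (u K)| / 2 := by
    have e : ∑' i, g (u (K + 1 + i)) - F (u K) = (∑' i, g (u (K + 1 + i)) - F (u K) + g (u K) / 2) - g (u K) / 2 := by ring
    conv_lhs => rw [e]
    refine (abs_sub _ _).trans ?_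
    rw [abs_div, abs_of_pos (by norm_num : (0:ℝ) < 2)]
  calc |∑' i, g (u (K + 1 + i)) - F (u K)| ≤ 9 * (4 * C₂ + σ * Cg) / u K ^ 2 + Cg / 2 / u K ^ 2 :=
        htri.trans (add_le_add hlim hgK)
    _ = (Cg / 2 + 9 * (4 * C₂ + σ * Cg)) / u K ^ 2 := by ring

/-! ## §5 The first-order sum law -/

/-- **THE FIRST-ORDER SUM LAW.**  u as above (σ ≥ 0); G with `G′ = G₁` on [1, ∞), G₁ continuous, `|G x| ≤ C_G`, `|G₁ x| ≤ C₁∕x`; S with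
`S′ = G` on [1, ∞).  Then for every N:
**`|Σ_{K<N} G(u_K) − (S(u_N) − S(u_0))| ≤ 8C₁·H_N + 6σC_G`**, `H_N = Σ_{K<N} 1∕(K+1)` (left-endpoint rule per cell `≤ s²C₁∕u_K ≤ 4C₁∕u_K`,
`Σ_{K<N} 1∕u_K ≤ 2H_N`; step defects `|1 − s_K|·|G(u_K)| ≤ σC_G∕u_{K+1}²`, `Σ 1∕u² ≤ 6`). [folklore] -/
theorem firstOrder_sum_le (hu0 : 1 ≤ u 0) (hstep : ∀ j, 1 / 2 ≤ u (j + 1) - u j ∧ u (j + 1) - u j ≤ 2)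
    (hσ0 : 0 ≤ σ) (hσ : ∀ j, |u (j + 1) - u j - 1| ≤ σ / u (j + 1) ^ 2)
    (hG : ∀ x : ℝ, 1 ≤ x → HasDerivAt G (G₁ x) x) (hG₁c : ContinuousOn G₁ (Ici 1))
    (hGb : ∀ x : ℝ, 1 ≤ x → |G x| ≤ CG) (hC₁ : 0 ≤ C₁) (hG₁b : ∀ x : ℝ, 1 ≤ x → |G₁ x| ≤ C₁ / x)
    (hS : ∀ x : ℝ, 1 ≤ x → HasDerivAt S (G x) x) (N : ℕ) :
    |∑ K ∈ range N, G (u K) - (S (u N) - S (u 0))| ≤ 8 * C₁ * (∑ K ∈ range N, ((K : ℝ) + 1)⁻¹) + 6 * σ * CG := by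
  have hpos := u_pos hu0 hstep
  have hone := u_one_le hu0 hstep
  have hCG : 0 ≤ CG := (abs_nonneg _).trans (hGb 1 le_rfl)
  have hcell : ∀ j, u j ≤ u (j + 1) := fun j => by have := (hstep j).1; linarith
  have hGI : ∀ j, ∀ x ∈ Icc (u j) (u (j + 1)), HasDerivAt G (G₁ x) x := fun j x hx => hG x ((hone j).trans hx.1)
  have hG₁I : ∀ j, ContinuousOn G₁ (Icc (u j) (u (j + 1))) := fun j => hG₁c.mono fun x hx => (hone j).trans hx.1
  -- per cell: |s_K G(u_K) − ∫_cell G| ≤ 4C₁/u_K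
  have hleft : ∀ K, |(u (K + 1) - u K) * G (u K) - ∫ x in (u K)..(u (K + 1)), G x| ≤ 4 * C₁ / u K := by
    intro K
    have hb : ∀ x ∈ Icc (u K) (u (K + 1)), |G₁ x| ≤ C₁ / u K := fun x hx =>
      (hG₁b x ((hone K).trans hx.1)).trans (div_le_div_of_nonneg_left hC₁ (hpos K) hx.1)
    refine (leftEndpoint_error_le (hcell K) (hGI K) (hG₁I K) hb).trans ?_
    have hs2 := (hstep K).2
    have hs0 : 0 ≤ u (K + 1) - u K := sub_nonneg.mpr (hcell K)
    have huK := hpos K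
    have : 0 ≤ C₁ / u K := by positivity
    have hs4 : (u (K + 1) - u K) ^ 2 ≤ 4 := by nlinarith
    calc (u (K + 1) - u K) ^ 2 * (C₁ / u K) ≤ 4 * (C₁ / u K) := mul_le_mul_of_nonneg_right hs4 this
      _ = 4 * C₁ / u K := by ring
  -- per cell: |(1 − s_K) G(u_K)| ≤ σ CG / u_{K+1}²
  have hdefK : ∀ K, |(1 - (u (K + 1) - u K)) * G (u K)| ≤ σ * CG * (1 / u (K + 1) ^ 2) := by
    intro K
    rw [abs_mul]
    have h1 : |1 - (u (K + 1) - u K)| ≤ σ / u (K + 1) ^ 2 := by rw [abs_sub_comm]; exact hσ K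
    have huK1 := hpos (K + 1)
    calc |1 - (u (K + 1) - u K)| * |G (u K)| ≤ σ / u (K + 1) ^ 2 * CG :=
          mul_le_mul h1 (hGb _ (hone K)) (abs_nonneg _) (by positivity)
      _ = σ * CG * (1 / u (K + 1) ^ 2) := by ring
  -- Σ ∫_cell G = S(u_N) − S(u_0)
  have hInt : ∑ K ∈ range N, ∫ x in (u K)..(u (K + 1)), G x = S (u N) - S (u 0) := by
    have hcellS : ∀ K, ∫ x in (u K)..(u (K + 1)), G x = S (u (K + 1)) - S (u K) := by
      intro K
      have hderiv : ∀ x ∈ uIcc (u K) (u (K + 1)), HasDerivAt S (G x) x := by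
        intro x hx; rw [uIcc_of_le (hcell K)] at hx; exact hS x ((hone K).trans hx.1)
      exact intervalIntegral.integral_eq_sub_of_hasDerivAt hderiv
        (ContinuousOn.intervalIntegrable_of_Icc (hcell K) fun x hx => (hGI K x hx).continuousAt.continuousWithinAt)
    rw [Finset.sum_congr rfl fun K _ => hcellS K]
    exact Finset.sum_range_sub (fun K => S (u K)) N
  -- pointwise split and sum
  have hsplit : ∀ K, G (u K) = (∫ x in (u K)..(u (K + 1)), G x)
      + (((u (K + 1) - u K) * G (u K) - ∫ x in (u K)..(u (K + 1)), G x) + (1 - (u (K + 1) - u K)) * G (u K)) :=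
    fun K => by ring
  have hkey : ∑ K ∈ range N, G (u K) - (S (u N) - S (u 0))
      = ∑ K ∈ range N, (((u (K + 1) - u K) * G (u K) - ∫ x in (u K)..(u (K + 1)), G x)
        + (1 - (u (K + 1) - u K)) * G (u K)) := by
    rw [Finset.sum_congr rfl fun K _ => hsplit K, Finset.sum_add_distrib, hInt]; ring
  rw [hkey]
  have hsq : ∑ K ∈ range N, 1 / u (K + 1) ^ 2 ≤ 6 := by
    rw [Finset.range_eq_Ico]
    have e : ∑ K ∈ Ico 0 N, 1 / u (K + 1) ^ 2 = ∑ j ∈ Ico 1 (N + 1), 1 / u j ^ 2 := by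
      rw [← Finset.sum_Ico_add' (fun j => 1 / u j ^ 2) 0 N 1]
    rw [e]
    refine (sum_inv_sq_le hu0 hstep (by omega : 1 ≤ N + 1)).trans ?_
    rw [div_le_iff₀ (hpos 1)]
    linarith [hone 1]
  calc |∑ K ∈ range N, (((u (K + 1) - u K) * G (u K) - ∫ x in (u K)..(u (K + 1)), G x)
        + (1 - (u (K + 1) - u K)) * G (u K))|
      ≤ ∑ K ∈ range N, |((u (K + 1) - u K) * G (u K) - ∫ x in (u K)..(u (K + 1)), G x)
        + (1 - (u (K + 1) - u K)) * G (u K)| := Finset.abs_sum_le_sum_abs _ _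
    _ ≤ ∑ K ∈ range N, (4 * C₁ * (1 / u K) + σ * CG * (1 / u (K + 1) ^ 2)) := by
        refine Finset.sum_le_sum fun K _ => (abs_add_le _ _).trans (add_le_add ?_ (hdefK K))
        have e : 4 * C₁ * (1 / u K) = 4 * C₁ / u K := by ring
        rw [e]; exact hleft K
    _ = 4 * C₁ * ∑ K ∈ range N, 1 / u K + σ * CG * ∑ K ∈ range N, 1 / u (K + 1) ^ 2 := by
        rw [Finset.sum_add_distrib, Finset.mul_sum, Finset.mul_sum]
    _ ≤ 4 * C₁ * (2 * ∑ K ∈ range N, ((K : ℝ) + 1)⁻¹) + σ * CG * 6 :=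
        add_le_add (mul_le_mul_of_nonneg_left (sum_inv_le_harmonic hu0 hstep N) (by positivity))
          (mul_le_mul_of_nonneg_left hsq (by positivity))
    _ = 8 * C₁ * (∑ K ∈ range N, ((K : ℝ) + 1)⁻¹) + 6 * σ * CG := by ring

end

end Summit.QuantumFields.BalabanUV.Beta.EriceFlowEnclosureUnitStepTailLawEnd
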